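import Mathlib
import Literature.Probability.RandomMatrix.TwoQubitSeparabilityVolumesBlochFibre
import Literature.Probability.RandomMatrix.TwoQubitSeparabilityVolumesQubitFibreProofs
import HarnessLib

/-!
# Two-qubit fibre volumes at Bloch length `a`: the Lovas–Andai scaling
# `vol(D^a) = (1 − a²)⁶ · vol(D⁰)` (Zhang–Jiang–Xie 2025, Prop. 6.7) and the reduction of
# `ZhangJiangXie2025_qubit_blochFibre_lambdaMax_ratio` to Prop. 6.10 in chart units

Companion of `TwoQubitSeparabilityVolumesBlochFibre.lean` (the named fact
`ZhangJiangXie2025_qubit_blochFibre_lambdaMax_ratio`, chart `qubitBlochFibreMatrix a x`, `x ∈ ℝ¹²`)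
and of `TwoQubitSeparabilityVolumesQubitFibreProofs.lean` (the `a = 0` fibre: `Kset`, `K'set`,
`volume_Kset_value : vol(D⁰) = π⁵/1238630400` in chart units).

## What is proved here (sorry-free)

* **Prop. 6.7, first display** ([LovasAndai2017, proof of Cor. 2: `Vol(𝒟_{4,𝕂}(D)) = χ_d(1)·det(D)^{4d−d²/2}/2^{6d}·∫…`
  with `d = 2`, `det D = ¼(1 − r²)`; cf. Cor. 1 for the separable part]; conjectured by Milz–Strunz):
  `vol(D^a) = (1 − a²)⁶ · vol(D⁰)` for `|a| < 1` (`volume_blochFibre_posSemidef`), hence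
  `vol(D^a) = (1 − a²)⁶ π⁵/1238630400` on the chart (`volume_blochFibre_posSemidef_value`).
  PROOF (a one-line change of variables, not the route of either source): the congruence
  `ρ ↦ M ρ M`, `M = 1₂ ⊗ diag(√(1−a), √(1+a)) = diag(√(1−a), √(1+a), √(1−a), √(1+a))`, maps the
  block-trace fibre over `diag((1+a)/2, (1−a)/2)` onto `(1 − a²)·`(the fibre over `½·1₂`), preserves
  positivity both ways (`M` is invertible), and in the entry coordinates `x ∈ ℝ¹²` it is the DIAGONAL
  linear map `blochScale` with determinant `(1 − a²)^{−6}` (`det_blochScale`); Lebesgue measure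
  scales accordingly (`Measure.addHaar_preimage_linearMap`).
* **Transport of the two-sided body** (`volume_blochFibre_twoSided`): the same congruence carries
  `½·1 − ρ` to `(1 − a²)·(diag4(1/(2(1+a)), 1/(2(1−a))) − ρ')`, so
  `vol{x : 0 ≼ ρ_a(x) ≼ ½·1} = (1 − a²)⁶ · vol{y : 0 ≼ ρ_0(y) ≼ ½(1₂ ⊗ diag((1+a)⁻¹, (1−a)⁻¹))}`:
  the source's `f(a) = vol_HS(D^a ∩ D_ss)` is a one-parameter family of sub-bodies of the FIXED
  fibre body `Kset` (at `a = 0` it is `K'set`).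
* **Reduction** (`blochFibre_lambdaMax_ratio_iff`): with the absolute value of `vol(D^a)` in hand,
  the named fact `ZhangJiangXie2025_qubit_blochFibre_lambdaMax_ratio` is EQUIVALENT to Prop. 6.10
  of the source in chart units,
  `vol{x : ρ_a(x) ≽ 0 ∧ ½·1 − ρ_a(x) ≽ 0} = π⁵(1−a)⁹(33a³+162a²+72a+8)/40874803200`, `a ∈ [0,1/3)`
  (`40874803200 = 33 · 1238630400`; the paper's `f(a) = π⁵(1−a)⁹(…)/319334400` is `2⁷` times the
  chart value, the constant HS/chart Jacobian, cf. `vol_HS(D⁰) = π⁵/9676800 = 2⁷ · π⁵/1238630400`).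
  This is exactly the part of the fact that is NOT proved in the tree: its only published proofs are
  the Duistermaat–Heckman computation of [ZhangJiangXie2025, Prop. 6.10, pp. 16–18 + App.] (Weyl
  integration over `U(4)`-orbits, the DH density of Prop. 6.4, a Mathematica-evaluated piecewise
  polynomial integral) and [HuongKhoi2024] (paywalled, acquisition pending); at `a = 0` it is the
  tree's `ZhangJiangXie2025.volume_K'set_value`.

## References

* [ZhangJiangXie2025] L. Zhang, X. Jiang, B. Xie, *One application of Duistermaat–Heckman measure in
  quantum information theory*, Quantum Inf. Comput. 25 (2025) 598–632 = arXiv:2507.02369, §6.1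
  Prop. 6.7 (p. 14), §6.2 Prop. 6.10 (p. 16), Remark 6.11 (p. 18).
* [LovasAndai2017] A. Lovas, A. Andai, *Invariance of separability probability over reduced states
  in 4 × 4 bipartite systems*, J. Phys. A 50 (2017) 295303 = arXiv:1610.01410, §3: proof of
  Corollary 2 (the display `Vol(𝒟_{4,𝕂}(D)) = χ_d(1) det(D)^{4d−d²/2} 2^{−6d} ∫ det(I−Y²)^d dλ(Y)`, i.e.
  `∝ det(D)⁶ = 4⁻⁶(1 − r²)⁶` for `d = 2`) and Corollary 1 (the same factor for the separable part).
* [HuongKhoi2024] H. T. Huong, V. T. Khoi, J. Phys. A 57 (2024) 445304.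
-/

noncomputable section

open _root_.MeasureTheory Set Real
open scoped ENNReal ComplexOrder Matrix
open Complex Matrix

namespace Literature.Probability.RandomMatrix


namespace ZhangJiangXie2025

/-! ## B1. The chart over a general diagonal marginal and the scaling map -/

/-- The fibre chart over the diagonal marginal `diag(p, q)`: `ρ = [[X, Z], [Z*, diag(p,q) − X]]` in
the entry coordinates `x ∈ ℝ¹²` (so `qubitBlochFibreMatrix a = blochAux ((1+a)/2) ((1−a)/2)` and
`qubitFibreMatrix = blochAux ½ ½`). [cite: ZhangJiangXie2025, §6.1 (D^a(ℂ²⊗ℂ²), p. 14)] -/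
def blochAux (p q : ℝ) (x : Fin 12 → ℝ) : Matrix (Fin 4) (Fin 4) ℂ :=
  !![((x 0 : ℝ) : ℂ), (⟨x 2, x 3⟩ : ℂ), (⟨x 4, x 5⟩ : ℂ), (⟨x 6, x 7⟩ : ℂ);
     (⟨x 2, -x 3⟩ : ℂ), ((x 1 : ℝ) : ℂ), (⟨x 8, x 9⟩ : ℂ), (⟨x 10, x 11⟩ : ℂ);
     (⟨x 4, -x 5⟩ : ℂ), (⟨x 8, -x 9⟩ : ℂ), ((p - x 0 : ℝ) : ℂ), (⟨-x 2, -x 3⟩ : ℂ);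
     (⟨x 6, -x 7⟩ : ℂ), (⟨x 10, -x 11⟩ : ℂ), (⟨-x 2, x 3⟩ : ℂ), ((q - x 1 : ℝ) : ℂ)]

/-- `qubitBlochFibreMatrix a = blochAux ((1+a)/2) ((1−a)/2)`. [folklore] -/
theorem qubitBlochFibreMatrix_eq_blochAux (a : ℝ) (x : Fin 12 → ℝ) :
    qubitBlochFibreMatrix a x = blochAux ((1 + a) / 2) ((1 - a) / 2) x := rfl

/-- `qubitFibreMatrix = blochAux ½ ½`. [folklore] -/
theorem qubitFibreMatrix_eq_blochAux (x : Fin 12 → ℝ) :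
    qubitFibreMatrix x = blochAux (1 / 2) (1 / 2) x := rfl

/-- The diagonal scale vector of the change of variables `D^{a} → D⁰` in the entry coordinates,
written through `u = √(1+a)`, `v = √(1−a)`: the diagonal entries of `X` scale by `u⁻²`, `v⁻²`, the
entries `z₁₁`, `z₂₂` of `Z` by `u⁻²`, `v⁻²`, and the four remaining complex entries by `(uv)⁻¹`.
[folklore] -/
def blochScaleVec (u v : ℝ) : Fin 12 → ℝ :=
  ![(u ^ 2)⁻¹, (v ^ 2)⁻¹, (u * v)⁻¹, (u * v)⁻¹, (u ^ 2)⁻¹, (u ^ 2)⁻¹, (u * v)⁻¹, (u * v)⁻¹,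
    (u * v)⁻¹, (u * v)⁻¹, (v ^ 2)⁻¹, (v ^ 2)⁻¹]

/-- The change of variables `D^{a} → D⁰` as a (diagonal) linear map of `ℝ¹²`. [folklore] -/
def blochScale (u v : ℝ) : (Fin 12 → ℝ) →ₗ[ℝ] (Fin 12 → ℝ) :=
  Matrix.toLin' (Matrix.diagonal (blochScaleVec u v))

/-- Unfolding lemma for `blochScale`. [folklore] -/
theorem blochScale_apply (u v : ℝ) (x : Fin 12 → ℝ) (k : Fin 12) :
    blochScale u v x k = blochScaleVec u v k * x k := by
  simp [blochScale, Matrix.toLin'_apply, mulVec_diagonal]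

/-- `det (blochScale u v) = ((u v)¹²)⁻¹`. [folklore] -/
theorem det_blochScale {u v : ℝ} (hu : u ≠ 0) (hv : v ≠ 0) :
    LinearMap.det (blochScale u v) = ((u * v) ^ 12)⁻¹ := by
  rw [blochScale, LinearMap.det_toLin', det_diagonal]
  simp only [blochScaleVec, Fin.prod_univ_succ, Fin.prod_univ_zero, Matrix.cons_val_zero,
    Matrix.cons_val_succ]
  field_simp

/-- The conjugating matrix `M = diag(v, u, v, u)` (`= 1₂ ⊗ diag(√(1−a), √(1+a))`). [folklore] -/
def blochConj (u v : ℝ) : Matrix (Fin 4) (Fin 4) ℂ :=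
  Matrix.diagonal ![(v : ℂ), (u : ℂ), (v : ℂ), (u : ℂ)]

/-- `M` is Hermitian (real diagonal). [folklore] -/
theorem conjTranspose_blochConj (u v : ℝ) : (blochConj u v)ᴴ = blochConj u v := by
  rw [blochConj, diagonal_conjTranspose]
  congr 1
  ext i
  fin_cases i <;> simp

/-- `M(u⁻¹, v⁻¹) · M(u, v) = 1`. [folklore] -/
theorem blochConj_inv_mul {u v : ℝ} (hu : u ≠ 0) (hv : v ≠ 0) :
    blochConj u⁻¹ v⁻¹ * blochConj u v = 1 := by
  rw [blochConj, blochConj, diagonal_mul_diagonal, ← diagonal_one]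
  congr 1
  ext i
  fin_cases i <;> simp [hu, hv]

/-- **The key identity**: `M · ρ_{p,q}(x) · M = (uv)² · ρ_{½,½}(T x)` for `p = u²/2`, `q = v²/2`,
`M = diag(v,u,v,u)`, `T = blochScale u v`. [folklore] -/
theorem blochConj_mul_blochAux_mul {u v : ℝ} (hu : u ≠ 0) (hv : v ≠ 0) (x : Fin 12 → ℝ) :
    blochConj u v * blochAux (u ^ 2 / 2) (v ^ 2 / 2) x * blochConj u v =
      (((u * v) ^ 2 : ℝ) : ℂ) • blochAux (1 / 2) (1 / 2) (blochScale u v x) := by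
  ext i j
  simp only [blochConj, diagonal_mul, mul_diagonal, Matrix.smul_apply, smul_eq_mul]
  fin_cases i <;> fin_cases j <;>
    simp [blochAux, blochScale_apply, blochScaleVec, Complex.ext_iff, -Complex.ofReal_pow,
      -Complex.ofReal_mul, -Complex.ofReal_inv, -Complex.ofReal_div, -Complex.ofReal_sub] <;>
    (try constructor) <;> field_simp

/-! ## B2. Positivity is preserved both ways -/

/-- `M(u,v) · M(u⁻¹,v⁻¹) = 1`. [folklore] -/
theorem blochConj_mul_inv {u v : ℝ} (hu : u ≠ 0) (hv : v ≠ 0) :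
    blochConj u v * blochConj u⁻¹ v⁻¹ = 1 := by
  rw [blochConj, blochConj, diagonal_mul_diagonal, ← diagonal_one]
  congr 1
  ext i
  fin_cases i <;> simp [hu, hv]

/-- Positivity transfers both ways along `M · A · M = (uv)² · B` (`u, v > 0`; `M = diag(v,u,v,u)` is
invertible and `(uv)² > 0`). [folklore] -/
theorem posSemidef_iff_of_blochConj {u v : ℝ} (hu : 0 < u) (hv : 0 < v)
    {A B : Matrix (Fin 4) (Fin 4) ℂ}
    (key : blochConj u v * A * blochConj u v = (((u * v) ^ 2 : ℝ) : ℂ) • B) :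
    A.PosSemidef ↔ B.PosSemidef := by
  have hc : (0 : ℂ) ≤ (((u * v) ^ 2 : ℝ) : ℂ) := Complex.zero_le_real.mpr (by positivity)
  have hc' : (0 : ℂ) ≤ ((((u * v) ^ 2)⁻¹ : ℝ) : ℂ) := Complex.zero_le_real.mpr (by positivity)
  constructor
  · intro h
    have h1 := h.mul_mul_conjTranspose_same (blochConj u v)
    rw [conjTranspose_blochConj, key] at h1
    have h2 := h1.smul hc'
    rwa [smul_smul, ← Complex.ofReal_mul, inv_mul_cancel₀ (by positivity : ((u * v) ^ 2 : ℝ) ≠ 0),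
      Complex.ofReal_one, one_smul] at h2
  · intro h
    have h1 : ((((u * v) ^ 2 : ℝ) : ℂ) • B).PosSemidef := h.smul hc
    rw [← key] at h1
    have h2 := h1.mul_mul_conjTranspose_same (blochConj u⁻¹ v⁻¹)
    have e : blochConj u⁻¹ v⁻¹ * (blochConj u v * A * blochConj u v) * blochConj u⁻¹ v⁻¹ = A := by
      rw [show blochConj u⁻¹ v⁻¹ * (blochConj u v * A * blochConj u v) * blochConj u⁻¹ v⁻¹ =
          (blochConj u⁻¹ v⁻¹ * blochConj u v) * A * (blochConj u v * blochConj u⁻¹ v⁻¹) by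
            simp only [Matrix.mul_assoc],
        blochConj_inv_mul hu.ne' hv.ne', blochConj_mul_inv hu.ne' hv.ne', Matrix.one_mul,
        Matrix.mul_one]
    rwa [conjTranspose_blochConj, e] at h2

/-- `ρ_{u²/2,v²/2}(x) ≽ 0 ⟺ ρ_{½,½}(T x) ≽ 0` (`T = blochScale u v`, `u, v > 0`). [folklore] -/
theorem posSemidef_blochAux_iff {u v : ℝ} (hu : 0 < u) (hv : 0 < v) (x : Fin 12 → ℝ) :
    (blochAux (u ^ 2 / 2) (v ^ 2 / 2) x).PosSemidef ↔
      (blochAux (1 / 2) (1 / 2) (blochScale u v x)).PosSemidef :=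
  posSemidef_iff_of_blochConj hu hv (blochConj_mul_blochAux_mul hu.ne' hv.ne' x)

/-- The positive body over `diag(u²/2, v²/2)` is the pull-back of `K = {ρ_{½,½} ≽ 0}` along `T`.
[folklore] -/
theorem setOf_posSemidef_blochAux_eq {u v : ℝ} (hu : 0 < u) (hv : 0 < v) :
    {x | (blochAux (u ^ 2 / 2) (v ^ 2 / 2) x).PosSemidef} = blochScale u v ⁻¹' Kset := by
  ext x
  simp only [mem_setOf_eq, mem_preimage, Kset, qubitFibreMatrix_eq_blochAux]
  exact posSemidef_blochAux_iff hu hv x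

/-! ## B3. Volumes -/

/-- `vol(T⁻¹ E) = (uv)¹² · vol(E)`. [folklore] -/
theorem volume_preimage_blochScale {u v : ℝ} (hu : 0 < u) (hv : 0 < v) (E : Set (Fin 12 → ℝ)) :
    volume (blochScale u v ⁻¹' E) = ENNReal.ofReal ((u * v) ^ 12) * volume E := by
  have hdet : LinearMap.det (blochScale u v) ≠ 0 := by
    rw [det_blochScale hu.ne' hv.ne']; positivity
  rw [Measure.addHaar_preimage_linearMap _ hdet E, det_blochScale hu.ne' hv.ne', inv_inv,
    abs_of_pos (by positivity)]

/-- **Zhang–Jiang–Xie 2025, Prop. 6.7, first display (Lovas–Andai 2017, proof of Cor. 2): the fibre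
volume scales as `(1 − a²)⁶`.** On the chart `ℝ¹²`:
`vol{x : ρ_a(x) ≽ 0} = (1 − a²)⁶ · vol{x : ρ_0(x) ≽ 0}` for `|a| < 1` (the source prints `a ∈ [0,1)`;
negative `a` is the mirror fibre). [cite: ZhangJiangXie2025, Prop. 6.7 (p. 14)]
[cite: LovasAndai2017, Corollary 2 (proof)] -/
theorem volume_blochFibre_posSemidef {a : ℝ} (ha₁ : -1 < a) (ha₂ : a < 1) :
    volume {x : Fin 12 → ℝ | (qubitBlochFibreMatrix a x).PosSemidef} =
      ENNReal.ofReal ((1 - a ^ 2) ^ 6) * volume Kset := by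
  set u := Real.sqrt (1 + a) with hu_def
  set v := Real.sqrt (1 - a) with hv_def
  have hu : 0 < u := Real.sqrt_pos.mpr (by linarith)
  have hv : 0 < v := Real.sqrt_pos.mpr (by linarith)
  have hu2 : u ^ 2 = 1 + a := Real.sq_sqrt (by linarith)
  have hv2 : v ^ 2 = 1 - a := Real.sq_sqrt (by linarith)
  have hset : {x : Fin 12 → ℝ | (qubitBlochFibreMatrix a x).PosSemidef} =
      blochScale u v ⁻¹' Kset := by
    rw [← setOf_posSemidef_blochAux_eq hu hv, hu2, hv2]
    rfl
  rw [hset, volume_preimage_blochScale hu hv]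
  congr 2
  calc (u * v) ^ 12 = (u ^ 2 * v ^ 2) ^ 6 := by ring
    _ = (1 - a ^ 2) ^ 6 := by rw [hu2, hv2]; ring

/-- **Prop. 6.7 in chart units: `vol{x : ρ_a(x) ≽ 0} = (1 − a²)⁶ · π⁵/1238630400`** (`|a| < 1`),
combining the scaling with the tree's `volume_Kset_value`. [cite: ZhangJiangXie2025, Prop. 6.7 (p. 14)] -/
theorem volume_blochFibre_posSemidef_value {a : ℝ} (ha₁ : -1 < a) (ha₂ : a < 1) :
    volume {x : Fin 12 → ℝ | (qubitBlochFibreMatrix a x).PosSemidef} =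
      ENNReal.ofReal ((1 - a ^ 2) ^ 6 * (π ^ 5 / 1238630400)) := by
  rw [volume_blochFibre_posSemidef ha₁ ha₂, volume_Kset_value, ← ENNReal.ofReal_mul (by positivity)]

/-! ## B5. Transport of the two-sided body `{ρ_a ≽ 0, ½·1 − ρ_a ≽ 0}` to the fixed chart -/

/-- The diagonal matrix `diag(p, q, p, q) = 1₂ ⊗ diag(p, q)` (real entries). [folklore] -/
def diag4 (p q : ℝ) : Matrix (Fin 4) (Fin 4) ℂ :=
  Matrix.diagonal ![(p : ℂ), (q : ℂ), (p : ℂ), (q : ℂ)]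

/-- `M · (½·1) · M = (uv)² · diag4((u²)⁻¹/2, (v²)⁻¹/2)`. [folklore] -/
theorem blochConj_mul_half_mul {u v : ℝ} (hu : u ≠ 0) (hv : v ≠ 0) :
    blochConj u v * ((2 : ℂ)⁻¹ • (1 : Matrix (Fin 4) (Fin 4) ℂ)) * blochConj u v =
      (((u * v) ^ 2 : ℝ) : ℂ) • diag4 ((u ^ 2)⁻¹ / 2) ((v ^ 2)⁻¹ / 2) := by
  rw [Matrix.mul_smul, Matrix.mul_one, Matrix.smul_mul, blochConj, diagonal_mul_diagonal, diag4]
  ext i j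
  simp only [Matrix.smul_apply, diagonal_apply, smul_eq_mul]
  fin_cases i <;> fin_cases j <;> simp [Complex.ext_iff, -Complex.ofReal_pow, -Complex.ofReal_mul,
    -Complex.ofReal_inv, -Complex.ofReal_div] <;> field_simp

/-- `M · (½·1 − ρ_{u²/2,v²/2}(x)) · M = (uv)² · (diag4((u²)⁻¹/2, (v²)⁻¹/2) − ρ_{½,½}(T x))`: the
upper barrier `λ_max ≤ ½` becomes `ρ ≼ ½ · (1₂ ⊗ diag(1/(1+a), 1/(1−a)))` on the fixed fibre.
[folklore] -/
theorem blochConj_mul_half_sub_mul {u v : ℝ} (hu : u ≠ 0) (hv : v ≠ 0) (x : Fin 12 → ℝ) :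
    blochConj u v * ((2 : ℂ)⁻¹ • (1 : Matrix (Fin 4) (Fin 4) ℂ) - blochAux (u ^ 2 / 2) (v ^ 2 / 2) x) *
        blochConj u v =
      (((u * v) ^ 2 : ℝ) : ℂ) •
        (diag4 ((u ^ 2)⁻¹ / 2) ((v ^ 2)⁻¹ / 2) - blochAux (1 / 2) (1 / 2) (blochScale u v x)) := by
  rw [Matrix.mul_sub, Matrix.sub_mul, blochConj_mul_blochAux_mul hu hv, blochConj_mul_half_mul hu hv,
    smul_sub]

/-- `½·1 − ρ_{u²/2,v²/2}(x) ≽ 0 ⟺ diag4((u²)⁻¹/2, (v²)⁻¹/2) − ρ_{½,½}(T x) ≽ 0`. [folklore] -/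
theorem posSemidef_half_sub_blochAux_iff {u v : ℝ} (hu : 0 < u) (hv : 0 < v) (x : Fin 12 → ℝ) :
    ((2 : ℂ)⁻¹ • (1 : Matrix (Fin 4) (Fin 4) ℂ) - blochAux (u ^ 2 / 2) (v ^ 2 / 2) x).PosSemidef ↔
      (diag4 ((u ^ 2)⁻¹ / 2) ((v ^ 2)⁻¹ / 2) - blochAux (1 / 2) (1 / 2) (blochScale u v x)).PosSemidef :=
  posSemidef_iff_of_blochConj hu hv (blochConj_mul_half_sub_mul hu.ne' hv.ne' x)

/-- The two-sided body over `diag(u²/2, v²/2)` is the pull-back along `T` of the body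
`{0 ≼ ρ_{½,½} ≼ diag4((u²)⁻¹/2, (v²)⁻¹/2)}` of the fixed fibre. [folklore] -/
theorem setOf_twoSided_blochAux_eq {u v : ℝ} (hu : 0 < u) (hv : 0 < v) :
    {x | (blochAux (u ^ 2 / 2) (v ^ 2 / 2) x).PosSemidef ∧
        ((2 : ℂ)⁻¹ • (1 : Matrix (Fin 4) (Fin 4) ℂ) - blochAux (u ^ 2 / 2) (v ^ 2 / 2) x).PosSemidef} =
      blochScale u v ⁻¹' {y | (qubitFibreMatrix y).PosSemidef ∧
        (diag4 ((u ^ 2)⁻¹ / 2) ((v ^ 2)⁻¹ / 2) - qubitFibreMatrix y).PosSemidef} := by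
  ext x
  simp only [mem_setOf_eq, mem_preimage, qubitFibreMatrix_eq_blochAux]
  rw [posSemidef_blochAux_iff hu hv, posSemidef_half_sub_blochAux_iff hu hv]

/-- **Transport of the `λ_max ≤ ½` body.** For `|a| < 1`:
`vol{x : ρ_a(x) ≽ 0 ∧ ½·1 − ρ_a(x) ≽ 0} = (1 − a²)⁶ · vol{y : 0 ≼ ρ_0(y) ≼ diag4(1/(2(1+a)), 1/(2(1−a)))}`,
i.e. Zhang–Jiang–Xie's `f(a) = vol_HS(D^a ∩ D_ss)` is `(1 − a²)⁶` times the volume of the sub-body of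
the FIXED fibre `D⁰` cut out by `ρ ≼ ½(1₂ ⊗ diag((1+a)⁻¹, (1−a)⁻¹))` (at `a = 0`: `K'set`). This
isolates what remains of Prop. 6.10 as a one-parameter family of sub-bodies of `Kset`.
[cite: ZhangJiangXie2025, Prop. 6.10 (the body D^a ∩ D_ss, p. 16)] -/
theorem volume_blochFibre_twoSided {a : ℝ} (ha₁ : -1 < a) (ha₂ : a < 1) :
    volume {x : Fin 12 → ℝ | (qubitBlochFibreMatrix a x).PosSemidef ∧
        ((2 : ℂ)⁻¹ • (1 : Matrix (Fin 4) (Fin 4) ℂ) - qubitBlochFibreMatrix a x).PosSemidef} =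
      ENNReal.ofReal ((1 - a ^ 2) ^ 6) *
        volume {y : Fin 12 → ℝ | (qubitFibreMatrix y).PosSemidef ∧
          (diag4 (2 * (1 + a))⁻¹ (2 * (1 - a))⁻¹ - qubitFibreMatrix y).PosSemidef} := by
  set u := Real.sqrt (1 + a) with hu_def
  set v := Real.sqrt (1 - a) with hv_def
  have hu : 0 < u := Real.sqrt_pos.mpr (by linarith)
  have hv : 0 < v := Real.sqrt_pos.mpr (by linarith)
  have hu2 : u ^ 2 = 1 + a := Real.sq_sqrt (by linarith)
  have hv2 : v ^ 2 = 1 - a := Real.sq_sqrt (by linarith)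
  have hp : (u ^ 2)⁻¹ / 2 = (2 * (1 + a))⁻¹ := by rw [hu2]; field_simp
  have hq : (v ^ 2)⁻¹ / 2 = (2 * (1 - a))⁻¹ := by rw [hv2]; field_simp
  have hset := setOf_twoSided_blochAux_eq hu hv
  rw [hp, hq, hu2, hv2] at hset
  rw [show {x : Fin 12 → ℝ | (qubitBlochFibreMatrix a x).PosSemidef ∧
        ((2 : ℂ)⁻¹ • (1 : Matrix (Fin 4) (Fin 4) ℂ) - qubitBlochFibreMatrix a x).PosSemidef} =
      {x | (blochAux ((1 + a) / 2) ((1 - a) / 2) x).PosSemidef ∧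
        ((2 : ℂ)⁻¹ • (1 : Matrix (Fin 4) (Fin 4) ℂ) - blochAux ((1 + a) / 2) ((1 - a) / 2) x).PosSemidef}
      from rfl, hset, volume_preimage_blochScale hu hv]
  congr 2
  calc (u * v) ^ 12 = (u ^ 2 * v ^ 2) ^ 6 := by ring
    _ = (1 - a ^ 2) ^ 6 := by rw [hu2, hv2]; ring

/-! ## B4. The reduction of the named fact to Prop. 6.10 in chart units -/

/-- **Reduction.** Given Prop. 6.7 in chart units, the named fact
`ZhangJiangXie2025_qubit_blochFibre_lambdaMax_ratio` is equivalent to the chart form of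
[ZhangJiangXie2025, Prop. 6.10]: `vol{x : ρ_a(x) ≽ 0 ∧ ½·1 − ρ_a(x) ≽ 0} =
π⁵ (1−a)⁹ (33a³+162a²+72a+8) / 40874803200` for `a ∈ [0, 1/3)` (`40874803200 = 33 · 1238630400`;
the printed `f(a) = π⁵(1−a)⁹(…)/319334400` is `2⁷` times this chart value). The right-hand side is
NOT proved here. [cite: ZhangJiangXie2025, Prop. 6.10 (p. 16) with Prop. 6.7 (p. 14)] -/
theorem blochFibre_lambdaMax_ratio_iff :
    ZhangJiangXie2025_qubit_blochFibre_lambdaMax_ratio ↔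
      ∀ a : ℝ, 0 ≤ a → a < 1 / 3 →
        volume {x : Fin 12 → ℝ | (qubitBlochFibreMatrix a x).PosSemidef ∧
            ((2 : ℂ)⁻¹ • (1 : Matrix (Fin 4) (Fin 4) ℂ) - qubitBlochFibreMatrix a x).PosSemidef} =
          ENNReal.ofReal
            (π ^ 5 * ((1 - a) ^ 9 * (33 * a ^ 3 + 162 * a ^ 2 + 72 * a + 8)) / 40874803200) := by
  unfold ZhangJiangXie2025_qubit_blochFibre_lambdaMax_ratio
  refine forall_congr' fun a => forall_congr' fun ha0 => forall_congr' fun ha3 => ?_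
  have ha1 : a < 1 := by linarith
  have hq : 0 < 1 - a ^ 2 := by nlinarith
  have hK := volume_blochFibre_posSemidef_value (by linarith) ha1
  set S' := {x : Fin 12 → ℝ | (qubitBlochFibreMatrix a x).PosSemidef ∧
      ((2 : ℂ)⁻¹ • (1 : Matrix (Fin 4) (Fin 4) ℂ) - qubitBlochFibreMatrix a x).PosSemidef} with hS'
  have hsub : S' ⊆ {x | (qubitBlochFibreMatrix a x).PosSemidef} := fun x hx => hx.1
  have hfin : volume S' ≠ ⊤ :=
    ne_top_of_le_ne_top (by rw [hK]; exact ENNReal.ofReal_ne_top) (measure_mono hsub)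
  rw [hK, ← ENNReal.ofReal_toReal hfin]
  set w := (volume S').toReal with hw
  have hw0 : 0 ≤ w := ENNReal.toReal_nonneg
  have hA : 0 < 33 * (1 - a ^ 2) ^ 6 := by positivity
  have hP : 0 ≤ (1 - a) ^ 9 * (33 * a ^ 3 + 162 * a ^ 2 + 72 * a + 8) := by
    have : 0 < 1 - a := by linarith
    positivity
  rw [← ENNReal.ofReal_mul hA.le, ← ENNReal.ofReal_mul hP,
    ENNReal.ofReal_eq_ofReal_iff (by positivity) (by positivity),
    ENNReal.ofReal_eq_ofReal_iff hw0 (by positivity)]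
  constructor
  · intro h
    apply mul_left_cancel₀ hA.ne'
    rw [h]
    ring
  · intro h
    rw [h]
    ring

end ZhangJiangXie2025

end Literature.Probability.RandomMatrix

end
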